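import Summits.BirchSwinnertonDyer.BirchSwinnertonDyer.Theorems.ClassRecordThreeCornerAtThreeShimuraOrderBoundDivOfImage
import Summits.BirchSwinnertonDyer.BirchSwinnertonDyer.Theorems.ClassRecordThreeCornerAtThreeShimuraPortTargetsOfImage
import HarnessLib

/-!
# THE SAVED ORDER BOUND AT ANY ODD INERT `p ∈ S`, IMAGE-KEYED, FROM THE LABELS ALONE — the non-print half of
# `Theorems.ShimuraInertSavedDisplayAtD W p q₁` per Heegner field (cell `bsd-stepL`, seat `bsd-stepL-corner3-p2` g9 = WIDTH-LEVER lane B;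
# `--supports stmt-BirchSwinnertonDyer-21420 --as helper`; serves crux 19065's `stub_savedDisplay57` road at `p ∈ {5, 7}` and 19109 ∕ 21420 at `p = 3`)

WHAT. `ShimuraKolyvaginOfImage.savedOrderBound_of_labels_ofImage`: for an odd prime `p ∈ S` (inert, unramified in `K`), `E[p]` irreducible over `ℚ`, a
labelled family `(ι, y, ys, ε)` on a Shimura frame (`LabelsAt ∧ LabelB6`, `d_K < −4`, `S` inert and prime to `d_K`, the other bad primes split), the four
mod-`p` IMAGE INPUTS over `K`, Poitou–Tate for Selmer structures (`hPT`), `casselsTate_levelInputs K` and the guarded index clause: if `y` is non-torsion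
then for every prime `q₁ ∉ S`
`ord_p #Ш(E/K)[p^∞] + 2·ord_p c_{q₁}(E) ≤ 2·ord_p [E(K) : ℤy]` — McCallum Cor. 5.6 under Jetchev's global `p^{ord_p c_{q₁}}`-divisibility, the latter
now a KERNEL consequence of the labels (lane B g9's `Koly.shimuraDivClause_of_poitouTate_ofImage`, p611034) fed to the image-keyed ORDER END
(`padicValNat_card_sha_primary_add_le_of_shimuraLabels_ofImage_of_casselsTate_of_divLab`, the `p`-generic D7) at `t := ord_p c_{q₁}`. This is exactly the
last conjunct of `Theorems.ShimuraInertSavedDisplayAtD W p q₁` at the frame; the other conjuncts (the point, the degree link, the Gross–Zagier display)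
are the printed primitives themselves. At `p = 3` it is the body of lane B g6's re-entry; at `p ∈ {5, 7}` on the T4′ corner (crux 19065 hybrid r5) the
image inputs are corner-p1's and the primitives are `shimuraCurve_heegnerSystem_primitivesFromFiveIrr` — the assembly into a D-form of `stub_savedDisplay57`
(+ (B6) as ONE ∃-constant with the primitives, RULING 47 style) is the 19065 line owner's.

HONEST FRAMING: ONE conditional theorem; no definition, no named fact, no `sorry`; its non-print inputs are (B6) for the family and the image inputs;
nothing booked; no stub ∕ item closes; no census label moves (T7); BSD is not proved by any of this.
References (locators only): [cite: Jetchev2008, Thm. 1.1, (1), Cor. 1.5 (p. 812)] [cite: McCallumLMS1991, §1 Theorem, Cor. 5.6] [cite: Kim2022HigherGZ,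
Rem. 7.9] [cite: GrossLMS1991, §3 (3.2), §6] [cite: MilneADT2006, Ch. I Thm. 4.10(b), Thm. 6.13(a)]. Axioms: `propext`, `Classical.choice`, `Quot.sound`.
-/

set_option autoImplicit false
set_option linter.dupNamespace false

noncomputable section

open scoped Classical AddSubgroup

open WeierstrassCurve NumberField IsDedekindDomain Field Function Finset Literature.NumberTheory.EllipticCurves
  Literature.NumberTheory.GaloisRepresentations Literature.NumberTheory.GaloisCohomology
  Literature.NumberTheory.EllipticCurves.KolyvaginCocycle Literature.NumberTheory.EllipticCurves.RingClassField
  Literature.NumberTheory.EllipticCurves.ModularForms Literature.NumberTheory.EllipticCurves.Rank1Residual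
  Literature.NumberTheory.EllipticCurves.KolyvaginEuler Literature.NumberTheory.EllipticCurves.KolyvaginDescent
  Summit.BirchSwinnertonDyer.Rank1Residual Summit.BirchSwinnertonDyer.Rank1Residual.X11b
  Literature.NumberTheory.EllipticCurves.ShimuraCMFamily

namespace Summit.BirchSwinnertonDyer.BirchSwinnertonDyer.Theorems.ShimuraKolyvaginOfImage

/-- **The SAVED order bound `ord_p #Ш(E/K)[p^∞] + 2·ord_p c_{q₁}(E) ≤ 2·ord_p [E(K):ℤy]` at any odd inert `p ∈ S`, `q₁ ∉ S`, from the labels, the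
four mod-`p` image inputs, Poitou–Tate ×2 and `casselsTate_levelInputs K`** — the `p`-generic D7 at `t := ord_p c_{q₁}` with its `hDivLab` DISCHARGED by
`Koly.shimuraDivClause_of_poitouTate_ofImage`. The last conjunct of `Theorems.ShimuraInertSavedDisplayAtD W p q₁` at the frame. CONDITIONAL; nothing booked.
[cite: Jetchev2008, Thm. 1.1 and Cor. 1.5] [cite: McCallumLMS1991, §1 Theorem (Kolyvagin), Cor. 5.6] [cite: Kim2022HigherGZ, Rem. 7.9] -/
theorem savedOrderBound_of_labels_ofImage
    (hPT : ∀ (K : Type) [Field K] [NumberField K], poitouTate_selmerStructure_duality_conj K)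
    (W : WeierstrassCurve ℚ) [W.IsElliptic] [W.IsGloballyMinimal] (N : ℕ) [NeZero N]
    (K : Type) [Field K] [NumberField K] (S : Finset ℕ) (Dt : ModularParametrizationData W N)
    (hN : W.conductorNorm ℤ = N) {p : ℕ} [Fact p.Prime] (hp2 : p ≠ 2) (hirr : W.HasIrreducibleModPGaloisRep p)
    (hK : IsImaginaryQuadratic K) (hD : NumberField.discr K < -4)
    (hin : ∀ ℓ ∈ S, ℓ.Prime ∧ ℓ ∣ N ∧ ¬ ℓ ^ 2 ∣ N ∧
      ((Ideal.span {(ℓ : ℤ)}).primesOver (𝓞 K)).ncard = 1 ∧ ¬ (ℓ : ℤ) ∣ NumberField.discr K)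
    (hsp : ∀ ℓ : ℕ, ℓ.Prime → ℓ ∣ N → ℓ ∉ S → ((Ideal.span {(ℓ : ℤ)}).primesOver (𝓞 K)).ncard = 2)
    (hpS : p ∈ S) (ι : K →+* ℂ) (y : (W.baseChange K).toAffine.Point)
    (ys : (m : ℕ) → (W.baseChange (ringClassField K ι m)).toAffine.Point) (ε : ℤ)
    (hL : ShimuraWalk.LabelsAt W N K ι y ys ε) (hB6 : LabelB6 ι W N (N.primeFactors.filter (· ∉ S)) ys)
    (hIz : ∃ z : Field.absoluteGaloisGroup K, ∀ t : geomTorsion (W.baseChange K) p, z • t = -t)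
    (hIs : (W.baseChange K).HasIrreducibleModPGaloisRep p)
    (hIc : ∀ f : geomTorsion (W.baseChange K) p →+ geomTorsion (W.baseChange K) p,
      (∀ (g : Field.absoluteGaloisGroup K) (t : geomTorsion (W.baseChange K) p), f (g • t) = g • f t) →
        ∃ k : ℤ, ∀ t, f t = k • t)
    (hIt : AddSubgroup.torsionBy (W.baseChange K).toAffine.Point (p : ℤ) = ⊥)
    (hCT : Literature.NumberTheory.EllipticCurves.casselsTate_levelInputs K)
    (hguard : ¬ IsOfFinAddOrder y → 0 < (AddSubgroup.zmultiples y).index) (hnt : ¬ IsOfFinAddOrder y)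
    (q₁ : ℕ) [Fact q₁.Prime] (hq₁S : q₁ ∉ S) :
    padicValNat p (Nat.card (AddCommGroup.primaryComponent (W.baseChange K).sha p)) +
        2 * padicValNat p ((W.baseChange ℚ_[q₁]).localTamagawaNumber ℤ_[q₁]) ≤
      2 * padicValNat p (AddSubgroup.zmultiples y).index := by
  obtain ⟨hε, hB2, hB3, hB3K, hB4, hB5⟩ := id hL
  have hDIV := Summit.BirchSwinnertonDyer.Rank1Residual.X11b.Three.Koly.shimuraDivClause_of_poitouTate_ofImage hPT W N K S Dt hN
    hp2 hirr hK hD hin hsp hpS ι y ys ε hL hB6 hIz hIs hIc hIt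
  exact padicValNat_card_sha_primary_add_le_of_shimuraLabels_ofImage_of_casselsTate_of_divLab hCT hN hp2 hirr hK ι Dt hin hsp hpS
    hIz hIs hIc hIt ys hε hguard hB2 hB3 hB3K hB4 hB5 _ (hDIV q₁ _ hq₁S le_rfl) hnt

end Summit.BirchSwinnertonDyer.BirchSwinnertonDyer.Theorems.ShimuraKolyvaginOfImage

end
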